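import Summits.QuantumFields.YangMills.Theorems.FluctuationComparisonRegPrIntLWregChartLevelNearLetters
import Summits.QuantumFields.YangMills.Theorems.FluctuationComparisonRegPrIntLWregCentralBondPlaquetteLetters
import HarnessLib

/-!
# LEVEL-NEAR for the WREG fibred-chart table — hypothesis form, and its proof by a ONE-SITE GAUGE UPGRADE

Cell `ym3-torus` (rung R3 of the YM ladder: continuum `SU(2)` Yang–Mills on `T³` — NOT `d = 4`, NOT infinite volume, NOT a mass gap, NOT Clay),
width seat `ym-ust-20520-w4` g14, helper for the crux `stmt-QuantumFields-20520` `UnitScaleTilt.FluctuationComparisonRegPrIntL` through the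
organ WREG of LINE g18-2 `Cruxes/FluctuationComparisonRegPrIntL/Lines/wreg_chart.lean` (ideator seat ym-r3-idea-1; v17): the stub
**LEVEL-NEAR `stub_levelFlatNear : LevelFlatNear`** — for a fixed level-`n` datum `W` and non-zero levels `t(j)`, for `fieldMeasure`-a.e.
environment `z`, the (unique) charted fine field over `W` with off-pivot coordinates `z` has no CHAIN-TOUCHING intermediate plaquette variable
`|Ū⁽ʲ⁾(∂p) − 1|`, `j < n`, exactly at `t(j)` (the chain-free plaquettes are the line's theorem `levelFlat_far`; `levelFlat_of_near` assembles).

WHY HYPOTHESIS FORM.  The stub is stated over the line's LOCAL recursive objects `iterCentralBond`, `chainMap`, `chainWindow` (a `Cruxes` module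
is not importable from `Theorems`).  Following the line owner's letter policy (LINE OWNER WORDS 2–3, 2026-08-29) the theorem here is stated for a
DISPLAYED system `β ∕ cm ∕ cw` whose defining recursions are hypotheses discharged by `rfl` ∕ `chainWindow_succ` for the line's objects, and whose
four structural facts (injectivity on the window, Lusin (N) on the window, blindness to resampling the pivots, joint measurability) are hypotheses
discharged BY NAME by the line's proved §0 theorems (`chainMap_injOn`, `chain_imageNull`, `chainMap_extend`, `chainWindow_extend`,
`measurableSet_chainWindow₂`, `measurable_chainMap₂`); the conclusion is `LevelFlatNear`'s body token for token under the dictionary, so the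
stub closes by `exact levelFlatNear_of_chain …` (door-fit certificate kept in the seat's HOME folder).

THE PROOF (no analyticity, no transversality; this retires the instrument row R3-WREG-FLAT as a falsifier of LEVEL-NEAR).  Fix `j < n`, a
plaquette `p` and the level-`n` bond `c` whose chain touches `p`.
* §1 (i) ONE PIVOT PER PLAQUETTE (`WregCentralBondPlaquetteLetters.eq_of_centralBond_mem_plaqBonds`, seat px21) + TRIANGULARITY of the iterated
  averaging in the displayed pivots (`isLocal_iter`, `iter_apply_eq_of_agree_off`, from `BlockAveragingHaarAC.isLocal_avgFun` and
  `T4TriangularPushforward.apply_eq_of_agree`): the plaquette variable of the charted field `U` over `(W, z)` is the SINGLE-PIVOT one,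
  `D(z, g) = |Ū⁽ʲ⁾(z[βₙc ↦ g])(∂p) − 1|` at `g = U(βₙ c)`, and the bad event depends on `W` only through the value `v = W c`.
* §3 (ii) SOFT HALF (`ae_ae_forall_not_of_prod_null`, abstract): for Haar-a.e. `v` the bad environments are `fieldMeasure`-null — Lusin–Souslin
  measurability of the injective image of the window graph, `Measure.prod_apply`, sections of null sets, `Measure.prod_swap`; inputs: Lusin (N)
  of the chain on its window, the resampling `(z, g) ↦ z[b ↦ g]` pushing `dU ⊗ Haar` to `dU` (`…AeUpgrade.measurePreserving_update_fieldMeasure`)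
  and the `dU`-nullity of threshold level sets of averaged plaquette variables (`fieldMeasure_setOf_dist1_plaqHol_iter_eq_zero`:
  `HaarAC` of (0.4) iterated + `PlaquetteVariableHaarLaw` + `HaarEigenvalueSphereNull`).
* §2 (iii) THE GAUGE UPGRADE a.e. `v` → EVERY `v`: for ANY fine gauge transformation `u`, `(z[b ↦ g])ᵘ = zᵘ[b ↦ u(b₋) g u(b₊)⁻¹]`
  (`gaugeAct_update`), the windows transform by that reparametrisation (`cw_gaugeAct`: `loopHol_update_centralBond_self`, `loopHol_gaugeAct`,
  `dist1_conj`), the chain values conjugate by the level-`k` image `u⁽ᵏ⁾` at the coarse endpoints (`cm_gaugeAct`: `T4Continuum.iter_gaugeAct`),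
  the plaquette variables are invariant (`dist1_plaqHol_iter_update_gaugeAct`); with the BLOCK-CONSTANT lift of the one-site level-`n`
  transformation `[c₊ ↦ h⁻¹]` (`T3UnitLawGaugeInvariance.transfUp_blockUp`) the top value moves `v ↦ v·h` while `fieldMeasure` is preserved
  (`B12RTGaugeInvariance254.measurePreserving_gaugeAct`); so the null-ness of the bad set at `v` is right-translation invariant on `SU(2)`,
  hence constant, hence zero everywhere from zero a.e. (`forall_of_ae_of_mul_right`).
* §4 the theorem `levelFlatNear_of_chain`.

HONEST SCOPE.  Measure theory and lattice bookkeeping about the published formula (0.4); no estimate of Bałaban's is asserted; the crux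
`FluctuationComparisonRegPrIntL`, the organ WREG, S2β and every rung statement are NOT proved here; `YM3TorusSU2` is NOT proved; the
Yang–Mills mass gap (Clay) is NOT proved.  Helper (`--supports stmt-QuantumFields-20520`), def-free, no `instance` ∕ `notation`.

References: T. Bałaban, Commun. Math. Phys. **109** (1987) 249–301 [Balaban1987RG1] (0.4) p. 253; Commun. Math. Phys. **98** (1985) 17–51
[Balaban1985Averaging] (8)–(12) p. 19; Commun. Math. Phys. **102** (1985) 255–275 [Balaban1985UV3] (7) p. 257; Th. Bröcker, T. tom Dieck,
*Representations of Compact Lie Groups* (1985) [BrockerTomDieck1985] IV (2.11).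
-/

noncomputable section

open MeasureTheory Filter Topology Set Function
open scoped ENNReal NNReal
open Literature.MathematicalPhysics.QuantumFieldTheory.Balaban1983to89
open Literature.MathematicalPhysics.QuantumFieldTheory.Balaban1983to89.T3UnitLawDensityEML (ℰp)
open Literature.MathematicalPhysics.QuantumFieldTheory.Balaban1983to89.BlockAveraging (Idx avgFun loopHol loopHol_gaugeAct measurable_avgFun)
open Literature.MathematicalPhysics.QuantumFieldTheory.Balaban1983to89.BlockAveragingHaarAC (centralBond centralBond_injective isLocal_avgFun pre post)
open Literature.MathematicalPhysics.QuantumFieldTheory.Balaban1983to89.BlockAveragingEMLHaarAC (fibreFamily loopHol_update_centralBond_self)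
open Literature.MathematicalPhysics.QuantumFieldTheory.Balaban1983to89.B14.Eq12InteriorLocality (plaqBonds mem_plaqBonds plaqHol_congr)
open Literature.MathematicalPhysics.QuantumFieldTheory.Balaban1983to89.T4Continuum (transfUp iter_gaugeAct)
open Literature.MathematicalPhysics.QuantumFieldTheory.Balaban1983to89.T4TriangularPushforward (IsLocal apply_eq_of_agree)
open Literature.MathematicalPhysics.QuantumFieldTheory.Balaban1983to89.T4WilsonGaugeFlatDirection (plaqHol_gaugeAct)
open Summit.QuantumFields.YangMills.Theorems.WregCentralBondPlaquetteLetters (eq_of_centralBond_mem_plaqBonds)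

namespace Summit.QuantumFields.YangMills.Theorems.FluctuationComparisonRegPrIntLWregChartLevelNear

/-! ## §4 The theorem -/

/-- ★★ **LEVEL-NEAR (hypothesis form; the registered stub `stub_levelFlatNear : LevelFlatNear` of LINE g18-2 under the dictionary
`iterCentralBond ↦ β`, `chainMap ℰp ↦ cm`, `chainWindow α ↦ cw`).**  For a displayed pivot ∕ chain ∕ window system of the iterated (0.4)
averaging on `SU(2)` — recursions `hβ0`, `hβs`, `hcm`, `hcw0`, `hcws` (all `rfl` ∕ `chainWindow_succ` for the line's objects), injectivity of the chain
on its window (`chainMap_injOn`), Lusin (N) on windows (`chain_imageNull`), blindness to resampling the pivots (`chainMap_extend`,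
`chainWindow_extend`) and joint measurability (`measurableSet_chainWindow₂`, `measurable_chainMap₂`) — for EVERY level-`n` datum `W` and
non-zero levels `t`, for `fieldMeasure`-a.e. environment `z`, every charted fine field `U` over `W` with off-pivot coordinates `z` has NO
chain-touching intermediate plaquette variable `|Ū⁽ʲ⁾U(∂p) − 1|`, `j < n`, exactly at `t j`.  PROOF: (i) one pivot per plaquette
(`WregCentralBondPlaquetteLetters.eq_of_centralBond_mem_plaqBonds`) + triangularity (`iter_apply_eq_of_agree_off`) reduce the plaquette variable to the
single-pivot one; (ii) for Haar-a.e. value `v = W c` the bad environments are null (`ae_ae_forall_not_of_prod_null`: Lusin–Souslin + Fubini over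
the Lusin-(N) window chain, the `(z, g) ↦ z[βₙc ↦ g]` resampling and the `fieldMeasure`-nullity of threshold level sets of averaged plaquette
variables); (iii) the ONE-SITE (block-constant lift) GAUGE UPGRADE: `z ↦ zᵘ` preserves `fieldMeasure`, transports windows and chain values
(`cw_gaugeAct`, `cm_gaugeAct`) and the plaquette variables (`dist1_plaqHol_iter_update_gaugeAct`), and sends `v ↦ v·h`; a.e. in `v` + right-translation
invariance ⇒ every `v` (`forall_of_ae_of_mul_right`).  No analyticity, no transversality input.
[cite: Balaban1987RG1, (0.4) p.253] [cite: Balaban1985Averaging, (8)-(12) p.19] [cite: Balaban1985UV3, (7) p.257] -/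
theorem levelFlatNear_of_chain (P : Params) (n : ℕ) (hn : n ≤ P.m + P.K) (α : ℝ) (t : ℕ → ℝ) (ht : ∀ j, t j ≠ 0)
    (W : GaugeField P n (Matrix.specialUnitaryGroup (Fin 2) ℂ))
    (β : (k : ℕ) → PBond P k → PBond P 0) (hβ0 : ∀ b, β 0 b = b)
    (hβs : ∀ k (c : PBond P (k + 1)), β (k + 1) c = β k (centralBond c))
    (cm : (k : ℕ) → GaugeField P 0 (Matrix.specialUnitaryGroup (Fin 2) ℂ) → PBond P k →
      Matrix.specialUnitaryGroup (Fin 2) ℂ → Matrix.specialUnitaryGroup (Fin 2) ℂ)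
    (hcm : ∀ k U (c : PBond P k) g, cm k U c g =
      Averaging.iter (fun i => BlockAveraging.blockAvg (P := P) (j := i) ℰp) k (update U (β k c) g) c)
    (cw : (k : ℕ) → GaugeField P 0 (Matrix.specialUnitaryGroup (Fin 2) ℂ) → PBond P k → Set (Matrix.specialUnitaryGroup (Fin 2) ℂ))
    (hcw0 : ∀ U (c : PBond P 0), cw 0 U c = univ)
    (hcws : ∀ k U (c : PBond P (k + 1)), cw (k + 1) U c = cw k U (centralBond c) ∩
      cm k U (centralBond c) ⁻¹'
        {h | ∀ i : Idx P, dist1 (fibreFamily (Averaging.iter (fun i => BlockAveraging.blockAvg (P := P) (j := i) ℰp) k U) c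
          (pre (Averaging.iter (fun i => BlockAveraging.blockAvg (P := P) (j := i) ℰp) k U) c * h *
            post (Averaging.iter (fun i => BlockAveraging.blockAvg (P := P) (j := i) ℰp) k U) c) i) ≤ α})
    (hinj : ∀ U (c : PBond P n), InjOn (cm n U c) (cw n U c))
    (hN : ∀ (U : GaugeField P 0 (Matrix.specialUnitaryGroup (Fin 2) ℂ)) (c : PBond P n) (A : Set (Matrix.specialUnitaryGroup (Fin 2) ℂ)),
      A ⊆ cw n U c → (HaarData.haar : Measure (Matrix.specialUnitaryGroup (Fin 2) ℂ)) A = 0 →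
        (HaarData.haar : Measure (Matrix.specialUnitaryGroup (Fin 2) ℂ)) (cm n U c '' A) = 0)
    (hext_cm : ∀ (g : PBond P n → Matrix.specialUnitaryGroup (Fin 2) ℂ) U (c : PBond P n), cm n (extend (β n) g U) c = cm n U c)
    (hext_cw : ∀ (g : PBond P n → Matrix.specialUnitaryGroup (Fin 2) ℂ) U (c : PBond P n), cw n (extend (β n) g U) c = cw n U c)
    (hmeas_cw : ∀ c : PBond P n,
      MeasurableSet {q : GaugeField P 0 (Matrix.specialUnitaryGroup (Fin 2) ℂ) × Matrix.specialUnitaryGroup (Fin 2) ℂ | q.2 ∈ cw n q.1 c})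
    (hmeas_cm : ∀ c : PBond P n,
      Measurable fun q : GaugeField P 0 (Matrix.specialUnitaryGroup (Fin 2) ℂ) × Matrix.specialUnitaryGroup (Fin 2) ℂ => cm n q.1 c q.2) :
    ∀ᵐ z ∂fieldMeasure P 0 (Matrix.specialUnitaryGroup (Fin 2) ℂ),
      ∀ U : GaugeField P 0 (Matrix.specialUnitaryGroup (Fin 2) ℂ),
        (∀ b, (∀ c, β n c ≠ b) → U b = z b) →
        (∀ c, U (β n c) ∈ cw n U c) →
        Averaging.iter (fun i => BlockAveraging.blockAvg (P := P) (j := i) ℰp) n U = W →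
          ∀ j, j < n → ∀ p : Plaq P j,
            (∃ b ∈ plaqBonds p, ∃ c : PBond P n, β j b = β n c) →
            dist1 (GaugeField.plaqHol (Averaging.iter (fun i => BlockAveraging.blockAvg (P := P) (j := i) ℰp) j U) p) ≠ t j := by
  -- notation
  have hβinj : ∀ {k : ℕ}, k ≤ P.m + P.K → Injective (β k) := fun hk => beta_injective β hβ0 hβs hk
  -- STEP A (the two halves): for every pivot value `v`, a.e. environment has no bad window point over `v`
  have stepA : ∀ j, j < n → ∀ (p : Plaq P j) (c : PBond P n) (v : Matrix.specialUnitaryGroup (Fin 2) ℂ),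
      ∀ᵐ z ∂fieldMeasure P 0 (Matrix.specialUnitaryGroup (Fin 2) ℂ), ∀ g ∈ cw n z c, cm n z c g = v →
        ¬ (dist1 (GaugeField.plaqHol (Averaging.iter (fun i => BlockAveraging.blockAvg (P := P) (j := i) ℰp) j
          (update z (β n c) g)) p) = t j) := by
    intro j hj p c
    -- (ii) the soft half: a.e. value
    have hae : ∀ᵐ v ∂(HaarData.haar : Measure (Matrix.specialUnitaryGroup (Fin 2) ℂ)),
        ∀ᵐ z ∂fieldMeasure P 0 (Matrix.specialUnitaryGroup (Fin 2) ℂ), ∀ g ∈ cw n z c, cm n z c g = v →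
          ¬ (dist1 (GaugeField.plaqHol (Averaging.iter (fun i => BlockAveraging.blockAvg (P := P) (j := i) ℰp) j
            (update z (β n c) g)) p) = t j) :=
      ae_ae_forall_not_of_prod_null (fieldMeasure P 0 (Matrix.specialUnitaryGroup (Fin 2) ℂ))
        (HaarData.haar : Measure (Matrix.specialUnitaryGroup (Fin 2) ℂ)) (fun z g => cm n z c g) (fun z => cw n z c)
        (fun z g => dist1 (GaugeField.plaqHol (Averaging.iter (fun i => BlockAveraging.blockAvg (P := P) (j := i) ℰp) j
            (update z (β n c) g)) p) = t j)
        (hmeas_cw c) (hmeas_cm c) (fun z => hinj z c) (fun z A hA hA0 => hN z c A hA hA0)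
        (measurableSet_dist1_plaqHol_iter_update p (β n c) (t j))
        (prod_setOf_dist1_plaqHol_iter_update_eq_zero (hj.le.trans hn) p (β n c) (ht j))
    -- (iii) the gauge upgrade: a.e. value ⇒ every value
    refine forall_of_ae_of_mul_right (HaarData.haar : Measure (Matrix.specialUnitaryGroup (Fin 2) ℂ)) hae ?_
    intro v h hv
    set u : GaugeTransf P 0 (Matrix.specialUnitaryGroup (Fin 2) ℂ) :=
      fun x => if T3UnitLawGaugeInvariance.blockUp n x = c.tgt then h⁻¹ else 1 with hu
    obtain ⟨hτt, hτs⟩ := transfUp_lift_single (G := Matrix.specialUnitaryGroup (Fin 2) ℂ) hn c h⁻¹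
    -- transport of the good event along `z₀ ↦ z₀^u`
    have htrans : ∀ z₀ : GaugeField P 0 (Matrix.specialUnitaryGroup (Fin 2) ℂ),
        (∀ g ∈ cw n z₀ c, cm n z₀ c g = v →
          ¬ (dist1 (GaugeField.plaqHol (Averaging.iter (fun i => BlockAveraging.blockAvg (P := P) (j := i) ℰp) j
            (update z₀ (β n c) g)) p) = t j)) →
        (∀ g ∈ cw n (GaugeField.gaugeAct u z₀) c, cm n (GaugeField.gaugeAct u z₀) c g = v * h →
          ¬ (dist1 (GaugeField.plaqHol (Averaging.iter (fun i => BlockAveraging.blockAvg (P := P) (j := i) ℰp) j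
            (update (GaugeField.gaugeAct u z₀) (β n c) g)) p) = t j)) := by
      intro z₀ hz g' hg' hcm' hD'
      rw [cw_gaugeAct ℰp α β hβs cm hcm cw hcw0 hcws u hn z₀ c] at hg'
      obtain ⟨g, hg, rfl⟩ := hg'
      rw [cm_gaugeAct ℰp β cm hcm u hn, hτs, hτt, one_mul, inv_inv] at hcm'
      rw [dist1_plaqHol_iter_update_gaugeAct ℰp u (hj.le.trans hn)] at hD'
      exact hz g hg (mul_right_cancel hcm') hD'
    have hq := (B12RTGaugeInvariance254.measurePreserving_gaugeAct (P := P) (j := 0)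
      (G := Matrix.specialUnitaryGroup (Fin 2) ℂ) (B12RTGaugeInvariance254.invTransf u)).quasiMeasurePreserving
    filter_upwards [hq.ae hv] with z hz
    have := htrans _ hz
    rwa [B12RTGaugeInvariance254.gaugeAct_gaugeAct_inv] at this
  -- STEP B: one a.e. set for all `(j, p, c)`, at the values `v = W c`
  have stepB : ∀ᵐ z ∂fieldMeasure P 0 (Matrix.specialUnitaryGroup (Fin 2) ℂ), ∀ j, j < n → ∀ (p : Plaq P j) (c : PBond P n),
      ∀ g ∈ cw n z c, cm n z c g = W c →
        ¬ (dist1 (GaugeField.plaqHol (Averaging.iter (fun i => BlockAveraging.blockAvg (P := P) (j := i) ℰp) j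
          (update z (β n c) g)) p) = t j) := by
    refine ae_all_iff.2 fun j => ?_
    by_cases hj : j < n
    · have h := ae_all_iff.2 fun p : Plaq P j => ae_all_iff.2 fun c : PBond P n => stepA j hj p c (W c)
      exact h.mono fun z hz _ => hz
    · exact Eventually.of_forall fun z hj' => absurd hj' hj
  -- STEP C (one pivot per plaquette + triangularity): the charted field's near-plaquette variable is the single-pivot one
  filter_upwards [stepB] with z hz U hUz hUw hUW j hj p hp hEq
  obtain ⟨b, hb, c, hbc⟩ := hp
  have hUext : U = extend (β n) (fun c' => U (β n c')) z := by
    funext b₀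
    by_cases h : ∃ c', β n c' = b₀
    · obtain ⟨c', rfl⟩ := h
      rw [(hβinj hn).extend_apply]
    · rw [extend_apply' _ _ _ h]
      exact hUz b₀ fun c' h' => h ⟨c', h'⟩
  have hcw_eq : cw n U c = cw n z c := by
    conv_lhs => rw [hUext]
    exact hext_cw _ _ _
  have hg_cw : U (β n c) ∈ cw n z c := hcw_eq ▸ hUw c
  have hg_cm : cm n z c (U (β n c)) = W c := by
    rw [← hext_cm (fun c' => U (β n c')) z c, ← hUext, hcm, update_eq_self, hUW]
  have hfar : GaugeField.plaqHol (Averaging.iter (fun i => BlockAveraging.blockAvg (P := P) (j := i) ℰp) j U) p =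
      GaugeField.plaqHol (Averaging.iter (fun i => BlockAveraging.blockAvg (P := P) (j := i) ℰp) j (update z (β n c) (U (β n c)))) p := by
    refine plaqHol_congr fun b' hb' => ?_
    refine iter_apply_eq_of_agree_off β hβ0 hβs ℰp hn c U (update z (β n c) (U (β n c))) ?_ hj.le b' ?_
    · intro b₀ hne
      by_cases h : ∃ c', β n c' = b₀
      · obtain ⟨c', rfl⟩ := h
        refine ⟨c', ?_, rfl⟩
        rintro rfl
        exact hne (by rw [update_self])
      · exact (hne (by rw [update_of_ne (fun h' => h ⟨c, h'.symm⟩), hUz b₀ fun c' h' => h ⟨c', h'⟩])).elim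
    · intro c' hc' heq
      obtain ⟨d, hd⟩ := exists_beta_eq_centralBond β hβs j hj c
      obtain ⟨d', hd'⟩ := exists_beta_eq_centralBond β hβs j hj c'
      have hb_eq : b = centralBond d := hβinj (by omega) (hbc.trans hd)
      have hb'_eq : b' = centralBond d' := hβinj (by omega) (heq.trans hd')
      have hdd' : d = d' := eq_of_centralBond_mem_plaqBonds (by omega) (hb_eq ▸ hb) (hb'_eq ▸ hb')
      exact hc' (hβinj hn (by rw [hd', hd, hdd']))
  exact hz j hj p c (U (β n c)) hg_cw hg_cm (hfar ▸ hEq)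

end Summit.QuantumFields.YangMills.Theorems.FluctuationComparisonRegPrIntLWregChartLevelNear

end
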